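import Mathlib
import Summits.ValiantsHypothesis.ValiantsHypothesis.Theses.FeketeSOS

/-!
# Disproof of `FeketeBoundedFanin` — findings (standing disprover `cdisprove`, gen 1, cycle 1; v4)

Crux `stmt-ValiantsHypothesis-3998` = `Summit.ValiantsHypothesis.ValiantsHypothesis.Theses.FeketeSOS.FeketeBoundedFanin`
(route FeketeSOS, rank 5): for every fixed top fan-in `s₀` there are `δ = δ(s₀) > 0` and `p₀` such that for all primes
`p ≥ p₀`, every weighted SOS representation `∑_{i<s₀} c_i g_i² = F_p := ∑_{m<p} (m|p) X^m` over `ℂ` with `deg g_i ≤ p²`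
has support-sum `∑_i |supp g_i| ≥ p^{1/2+δ}`.

## VERDICT SO FAR: no kill; the crux resists (details §R).  What IS proved here (all `sorry`-free) — LANDED in tree as
`Summits.ValiantsHypothesis.ValiantsHypothesis.Theorems.FeketeBoundedFanin.Negative.{LoadBearing, NonVacuity}`
(p74579: §0, §A, §A2 with the propositions spelled out inline; p74590: §B; namespace `…Theorems.FeketeBoundedFanin.Negative`,
importable by ideators / planners / the lead):

* §A LOAD-BEARING `χ_p` (`feketeBoundedFanin_false_without_legendre`): replace the Legendre signs by the constant sign
  `+1` on the same support `[1, p-1]` (everything else verbatim: primes, degree cap `p²`, `∀ s₀ ∃ δ ∃ p₀` shape) and the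
  statement is FALSE already at `s₀ = 4`: `U_p := ∑_{1 ≤ m < p} X^m = A·B + C` with `A = X ∑_{a<k} X^a`, `B = ∑_{b<k} X^{kb}`,
  `C = X^{k²+1} ∑_{j<r} X^j` (`k = ⌊√(p-1)⌋`, `r = p-1-k² ≤ 2k`), hence `U_p = ¼(A+B)² − ¼(A−B)² + ¼(C+1)² − ¼(C−1)²` with
  support-sum `≤ 8k + 2 < 11√p ≤ p^{1/2+δ}` as soon as `p ≥ 11^{1/δ}`.  So any proof must use the sign pattern of `χ_p`, not
  only `|coeff| = 1`, `supp = [1,p-1]`, the counting layer (`TrivialSupportBound`, `ThinSquaresCovering`) or the degree cap: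
  those are all shared by `U_p`.  Equivalently: the natural STRENGTHENING "the bound holds for every `±1`-coefficient target of
  length `p-1`" is false (same witness).
* §A2 LOAD-BEARING PRIMALITY (`feketeBoundedFanin_false_with_jacobi`): weaken "`p` prime" to "`p` odd" with the
  Jacobi symbol (on primes the statement is verbatim the crux) and it is FALSE already at `s₀ = 2`: for prime `q`,
  `∑_{m<q²} J(m|q²) X^m = (∑_{1≤a<q} X^a)(∑_{b<q} X^{qb})` is a single sparse product (support-sum `4q − 2 = O(√n)`
  as two squares).  Periodicity of `χ` modulo a proper divisor is exactly the digit structure that makes squares cheap;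
  the proof must use primality (squarefreeness) beyond the typing of `legendreSym` — as the sibling's char-`p` lever does.
* §B NON-VACUITY / TRIVIAL CEILING (`feketeBoundedFanin_hypotheses_inhabited`): for every prime `p` the hypotheses are
  satisfiable at `s₀ = 2` (`F_p = ¼(F_p+1)² − ¼(F_p−1)²`, degrees `≤ p-1 ≤ p²`, support-sum `≤ 2p + 2`), so the cases
  `s₀ ≥ 2` have content, and the true minimal support-sum for fixed `s₀ ≥ 2` lies in `[claimed p^{1/2+δ}, 2p+2]`;
  EXACTLY `s₀ = 0, 1` are vacuous (`feketeBoundedFanin_vacuous_at_zero/one`: `0 ≠ F_p`, and `c·g² ≠ F_p` because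
  `X ∥ F_p` — `C_mul_sq_ne_fekete`).

## §R WHY IT RESISTS (paper; evidence for the provers) — read together with the two sibling work files
`Cruxes/FeketeSOSHard/Disproof.lean` (crux 3996: digit/near-tiling RANK data to `p ≤ 5563`, Gauss product formula,
Gauss-period near-miss, `digitRank_remark` / `cyclic_remark` / `resists_remark`) and `Cruxes/FeketeNoSparseSplit/`
(crux 3997: the `s = 2` char-`p` lever).  Division of labour: this file owns the `s₀`-indexed statements (vacuity,
inhabitedness, load-bearing lemmas for THIS crux — landed as `Theorems/FeketeBoundedFanin/Negative/{LoadBearing,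
NonVacuity}.lean`, p74579 / p74590) and the analysis of the first open fan-in `s₀ = 3`.
1. `s₀ ≤ 2` is TRUE with a LINEAR bound: `c₀g₀² + c₁g₁² = (a g₀ + i b g₁)(a g₀ − i b g₁)` is a splitting (for
   `s₀ = 2` the degree cap is even automatic: `deg A + deg B = p − 1`), and the sibling card
   `Cruxes/FeketeNoSparseSplit/Ideas/cyclic-valuation-dichotomy.md` (triage r1: pass) proves
   `|supp A| + |supp B| ≥ (p+3)/2` for every `A·B = F_p`: modulo `p`, `F_p ≡ (−1)^h · X · A_h(X) · (X−1)^h`,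
   `h = (p−1)/2`, `A_h` = Eulerian polynomial (derivation: `F̄_p = ∑ m^h X^m = θ^h((X−1)^{p−1})`, `θ = X d/dX`;
   check `p = 5`: `X(X+1)(X−1)² = X − X² − X³ + X⁴ = F_5`), and a `t`-nomial of degree `< p` vanishes at `X = 1` to
   order `≤ t − 1` in characteristic `p` (binomial Vandermonde).  Hence a disproof needs `s₀ ≥ 3`, and by §B the
   vacuous cases are exactly `s₀ ≤ 1`: THE FIRST OPEN CASE IS `s₀ = 3`, i.e. `F_p = A·B + c·C²`.
2. `s₀ = 3`: the char-`p` lever is MULTIPLICATIVE (`ord(AB) = ord A + ord B`) and dies on sums.  At a (discrete,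
   WLOG) place above `p` the first layer has two cancelling branches it cannot see: (i) Gauss valuations equal and
   negative, reductions satisfy `ĀB̄ + c̄C̄² = 0` in `k[X]` (e.g. `Ā = B̄ = C̄`; any Pythagorean triple of sparse
   polynomials); (ii) all valuations `0` but cyclic orders `ord Ã + ord B̃ = 2·ord C̃ < h` with cancelling leading
   terms.  Hensel layering keeps every `π`-adic layer of a sparse `g` supported inside `supp g` (the one structural
   fact that survives), but the last layer is a SUM of products of `supp`-supported polynomials, on which only the
   covering bound `|S + S| ≥ p − 1` acts.  THE SIMPLEST SHAPE ON WHICH EVERY KNOWN OBSTRUCTION IS SILENT: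
   `A·B = F_p − c·X^{2e}` with `p ∤ c` (`C = √c·X^e` a monomial; `2e` may exceed `p − 1`, a far monomial allowed by
   the degree cap `p²`): mod `p` the right side has `(X−1)`-order `0`, covering gives only `|A||B| ≥ p − 2`, and the
   rigidity of the factorisations of `F_p` itself (exhaustive minima `≥ 0.74p`, `p ≤ 29`) does not transfer to a
   one-monomial perturbation.  Kit jobs j010035–j010038 (`jobA/pert.py`: exact Gröbner feasibility over two word
   primes of `A·B = F_p − cX^{2e}`, `c ≠ 0`, all supports `0 ∈ S`, `min T = 1`, `|S|+|T| ≤ 7…10`, exponents `< 2p`,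
   `p = 7, 11, 13, 17`) measure whether a perturbation ever factors MORE sparsely than `F_p`; results → §C when
   they land (farm saturated at filing time).
3. No identity in sight (this seat; the sibling file lists theta products and Gauss periods as further near-misses).
   Checked and useless for sparsity: `χ = J(ψ,ψ)⁻¹ ψ∗ψ` cyclically for `p ≡ 1 (4)` (one DENSE square
   `+ (1 − X^p)·K`, ~3p monomials); `∑_j χ(j) U_p(ζ^j X) = G(χ) F_p` (p−1 sparse products, `~p^{3/2}` monomials);
   `χ(2)F_p(X²) − F_p(X) = (X^p − 1) F_p^{odd}(X)` and `(1−X)F_p` has exactly `(p+3)/2` monomials, but the model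
   allows neither division nor truncation; digit decompositions `F_p = ∑_{t<r} Q_t(X) Λ_t(X^k)` need
   `rank (χ(a+kb))_{a,b<k} = r`, which is `≥ log₂ k` trivially (a rank-`r` `±1` matrix has `≤ 2^r` distinct rows;
   rows are distinct by Weil once `k ≫ √p log p`), `≥ c log p/log log p` by the sibling's minors argument, and FULL
   up to deficiency `≤ 2` in the sibling's measurements (`p ≤ 5563`).  CRT aside (why "prime" matters twice): for a
   squarefree composite `n = pq` the Jacobi–Fekete polynomial is CYCLICALLY a sparse product,
   `∑ J(m|pq)X^m ≡ F_p(X^u)·F_q(X^v) (mod X^{pq} − 1)` (`u ≡ 1,0`, `v ≡ 0,1 mod p,q`; `p + q ≈ 2√n` monomials), but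
   not as honest polynomials (the exponents `ua + vb` overshoot `pq` by data-dependent multiples); for `n = q²` it is
   an honest sparse product (§A2).  Parameter count: `S` free coefficients against `p − 1` sign constraints — a
   counterexample at `S = p^{1/2+o(1)}` means each coefficient explains `p^{1/2−o(1)}` Legendre signs along additive
   grids (Paley-clique territory: nothing provable by completion, but every heuristic says the true minimum is LINEAR
   in `p`, even in characteristic `p`: `p^{2S}` sparse configurations against `p` equations ⇒ `p^{2S−p}` expected
   solutions; dividing `F_p + γ` by a `t`-nomial in any characteristic leaves `≥ (p−1)/t` monomials).
4. Small models (kit jobs, folder `jobA/`, `jobB/`): j008168 / j008170 (`p = 7`, `s₀ = 3`, `S ≤ 7`, modes char0 /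
   cyc), j008171 / j008172 (`p = 11`, `S ≤ 8`), j008173 (`p = 13`, `S ≤ 9`) — exact Gröbner feasibility of
   `∑_{i<3} g_i² = F_p` over ALL supports of total size `≤ S` inside `[0, p)` (char 0 via two word primes; `cyc` = the
   cyclic char-`p` shadow in `𝔽̄_p[X]/(X^p−1)`, which tests whether the char-`p` information already dies at
   `s₀ = 3`); j009356 (`jobB/`: Levenberg–Marquardt scan of all two-grid / three-grid digit supports, `s₀ = 4, 6`,
   `11 ≤ p ≤ 101`, best relative residual per prime); j010035–8 (item 2).  All queued behind a saturated farm at the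
   time of writing; §C will hold the numbers.  Known (item evidence of stmt-3997): `s₀ = 2` exhaustive minima
   `4,7,9,10,14,15,23,22` for `p = 5,…,29` (never below `0.74 p`).

## CONTENTS
* §0 helpers (support cards of sums of monomials, a block geometric-series identity).
* §A `FeketeBoundedFaninWithoutLegendre`, `allOnes_eq_prod_add` (the identity), `feketeBoundedFanin_false_without_legendre`.
* §A2 `FeketeBoundedFaninJacobi`, `jacobiSym_sq_block`, `jacobi_sq_sum_eq`, `feketeBoundedFanin_false_with_jacobi`.
* §B `fekete`, `C_mul_sq_ne_fekete`, `feketeBoundedFanin_vacuous_at_zero/one`, `feketeBoundedFanin_hypotheses_inhabited`.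
* §C small-model numbers (`smallModels_remark`).
* `-- Targets`: none yet (payload `stuck_stubs = []`).
* NEAR-MISSES: none (nothing came close to a kill).
-/

set_option linter.dupNamespace false

namespace Summit.ValiantsHypothesis.ValiantsHypothesis.Cruxes.FeketeBoundedFanin.Disproof

open Polynomial Finset
open scoped BigOperators

noncomputable section

/-! ## §0 Helpers -/

/-- Support card is subadditive over finite sums. [folklore] -/
theorem card_support_sum_le {ι : Type*} (s : Finset ι) (q : ι → ℂ[X]) :
    (∑ i ∈ s, q i).support.card ≤ ∑ i ∈ s, (q i).support.card := by
  classical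
  induction s using Finset.induction_on with
  | empty => simp
  | @insert a s ha ih =>
    rw [Finset.sum_insert ha, Finset.sum_insert ha]
    exact (Finset.card_le_card Polynomial.support_add).trans
      ((Finset.card_union_le _ _).trans (Nat.add_le_add le_rfl ih))

/-- A sum of `#s` monomials has at most `#s` monomials. [folklore] -/
theorem card_support_sum_X_pow_le (s : Finset ℕ) (f : ℕ → ℕ) :
    (∑ a ∈ s, (X : ℂ[X]) ^ f a).support.card ≤ s.card := by
  refine (card_support_sum_le s _).trans ?_
  calc ∑ a ∈ s, ((X : ℂ[X]) ^ f a).support.card ≤ ∑ a ∈ s, 1 :=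
        Finset.sum_le_sum fun a _ => by rw [Polynomial.support_X_pow]; simp
    _ = s.card := by simp

/-- Block geometric series: `(∑_{i<m} x^i)(∑_{j<n} x^{mj}) = ∑_{l<mn} x^l`. [folklore] -/
theorem geom_block (x : ℂ[X]) (m n : ℕ) :
    (∑ i ∈ range m, x ^ i) * (∑ j ∈ range n, x ^ (m * j)) = ∑ l ∈ range (m * n), x ^ l := by
  induction n with
  | zero => simp
  | succ n ih =>
    rw [Finset.sum_range_succ, mul_add, ih, Nat.mul_succ, Finset.sum_range_add, Finset.sum_mul]
    congr 1
    refine Finset.sum_congr rfl fun i _ => ?_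
    rw [← pow_add, add_comm]

/-- natDegree of a sum of monomials `X^{f a}` with `f a ≤ N` is `≤ N`. [folklore] -/
theorem natDegree_sum_X_pow_le (s : Finset ℕ) (f : ℕ → ℕ) (N : ℕ) (h : ∀ a ∈ s, f a ≤ N) :
    (∑ a ∈ s, (X : ℂ[X]) ^ f a).natDegree ≤ N :=
  natDegree_sum_le_of_forall_le _ _ fun a ha => (natDegree_X_pow_le _).trans (h a ha)

/-! ## §A `χ_p` is load-bearing: the all-ones target of the same length has support-sum `O(√p)` with 4 squares -/

/-- The crux `FeketeBoundedFanin` with the arithmetic of `χ_p` deleted: the Legendre symbol `(m|p)` is replaced by the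
constant sign `1` for `m ≠ 0` (and `0` at `m = 0`, as `(0|p) = 0`), i.e. the target is `U_p = ∑_{1 ≤ m < p} X^m`;
every other token (prime lengths, degree cap `p²`, quantifier shape, support-sum measure) is verbatim. -/
def FeketeBoundedFaninWithoutLegendre : Prop :=
  ∀ s₀ : ℕ, ∃ δ : ℝ, 0 < δ ∧ ∃ p₀ : ℕ, ∀ (p : ℕ) [Fact p.Prime], p₀ ≤ p → ∀ (c : Fin s₀ → ℂ) (g : Fin s₀ → Polynomial ℂ), (∀ i, (g i).natDegree ≤ p ^ 2) → (∑ i, Polynomial.C (c i) * g i ^ 2) = ∑ m ∈ Finset.range p, Polynomial.C ((if m = 0 then (0 : ℤ) else 1 : ℤ) : ℂ) * Polynomial.X ^ m → (p : ℝ) ^ (1 / 2 + δ) ≤ ∑ i, ((g i).support.card : ℝ)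

/-- Low block `A_k = X · ∑_{a<k} X^a` (k monomials). -/
def blockA (k : ℕ) : ℂ[X] := ∑ a ∈ range k, X ^ (a + 1)
/-- Comb `B_k = ∑_{b<k} X^{kb}` (k monomials). -/
def blockB (k : ℕ) : ℂ[X] := ∑ b ∈ range k, X ^ (k * b)
/-- Tail `C_{k,r} = X^{k²+1} ∑_{j<r} X^j` (r monomials). -/
def blockC (k r : ℕ) : ℂ[X] := ∑ j ∈ range r, X ^ (k * k + 1 + j)
/-- The all-ones target `U_p = ∑_{m<p} [m ≠ 0] X^m`, typed exactly as in `FeketeBoundedFaninWithoutLegendre`. -/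
def allOnes (p : ℕ) : ℂ[X] := ∑ m ∈ Finset.range p, Polynomial.C ((if m = 0 then (0 : ℤ) else 1 : ℤ) : ℂ) * Polynomial.X ^ m

/-- `A_k · B_k = X · ∑_{l<k²} X^l` (block geometric series). [folklore] -/
theorem blockA_mul_blockB (k : ℕ) : blockA k * blockB k = ∑ l ∈ range (k * k), (X : ℂ[X]) ^ (l + 1) := by
  have hA : blockA k = X * ∑ a ∈ range k, (X : ℂ[X]) ^ a := by
    rw [blockA, Finset.mul_sum]
    exact Finset.sum_congr rfl fun a _ => by rw [pow_succ, mul_comm]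
  rw [hA, blockB, mul_assoc, geom_block, Finset.mul_sum]
  exact Finset.sum_congr rfl fun l _ => by rw [pow_succ, mul_comm]

/-- `U_p = ∑_{m<p-1} X^{m+1}` (drop the vanishing `m = 0` term). [folklore] -/
theorem allOnes_eq_sum (p : ℕ) (hp : 1 ≤ p) : allOnes p = ∑ m ∈ range (p - 1), (X : ℂ[X]) ^ (m + 1) := by
  obtain ⟨n, rfl⟩ : ∃ n, p = n + 1 := ⟨p - 1, by omega⟩
  rw [allOnes, Finset.sum_range_succ']
  simp

/-- The digit identity `U_p = A_k B_k + C_{k,r}` whenever `k² ≤ p − 1` and `r = p − 1 − k²`. [folklore] -/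
theorem allOnes_eq_prod_add (p k r : ℕ) (hp : 1 ≤ p) (hkk : k * k ≤ p - 1) (hr : r = p - 1 - k * k) :
    allOnes p = blockA k * blockB k + blockC k r := by
  rw [allOnes_eq_sum p hp, blockA_mul_blockB, blockC]
  conv_lhs => rw [show p - 1 = k * k + r by omega]
  rw [Finset.sum_range_add]
  congr 1
  exact Finset.sum_congr rfl fun j _ => by congr 1; ring

/-- `A_k` has at most `k` monomials. [folklore] -/
theorem card_support_blockA (k : ℕ) : (blockA k).support.card ≤ k := by
  simpa [blockA] using card_support_sum_X_pow_le (range k) (fun a => a + 1)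
/-- `B_k` has at most `k` monomials. [folklore] -/
theorem card_support_blockB (k : ℕ) : (blockB k).support.card ≤ k := by
  simpa [blockB] using card_support_sum_X_pow_le (range k) (fun b => k * b)
/-- `C_{k,r}` has at most `r` monomials. [folklore] -/
theorem card_support_blockC (k r : ℕ) : (blockC k r).support.card ≤ r := by
  simpa [blockC] using card_support_sum_X_pow_le (range r) (fun j => k * k + 1 + j)

/-- `deg A_k ≤ k`. [folklore] -/
theorem natDegree_blockA (k : ℕ) : (blockA k).natDegree ≤ k := by
  unfold blockA
  exact natDegree_sum_X_pow_le (range k) (fun a => a + 1) k fun a ha => by simp at ha; omega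
/-- `deg B_k ≤ k²`. [folklore] -/
theorem natDegree_blockB (k : ℕ) : (blockB k).natDegree ≤ k * k := by
  unfold blockB
  exact natDegree_sum_X_pow_le (range k) (fun b => k * b) (k * k) fun b hb => by
    simp at hb; exact Nat.mul_le_mul_left k (by omega)
/-- `deg C_{k,r} ≤ k² + r`. [folklore] -/
theorem natDegree_blockC (k r : ℕ) : (blockC k r).natDegree ≤ k * k + r := by
  unfold blockC
  exact natDegree_sum_X_pow_le (range r) (fun j => k * k + 1 + j) (k * k + r) fun j hj => by simp at hj; omega

/-- `C ¼ · 4 = 1` in `ℂ[X]`. [folklore] -/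
theorem C_inv_four_mul_four : (C (4⁻¹ : ℂ)) * 4 = (1 : ℂ[X]) := by
  rw [← Polynomial.C_ofNat 4, ← map_mul, inv_mul_cancel₀ (by norm_num : (4 : ℂ) ≠ 0), map_one]

/-- `1` has at most one monomial. [folklore] -/
theorem card_support_one_le : (1 : ℂ[X]).support.card ≤ 1 := by
  simpa using (card_support_C_mul_X_pow_le_one (R := ℂ) (c := 1) (n := 0))

/-- Support card is subadditive. [folklore] -/
theorem card_support_add_le' (P Q : ℂ[X]) : (P + Q).support.card ≤ P.support.card + Q.support.card :=
  (Finset.card_le_card support_add).trans (Finset.card_union_le _ _)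

/-- Support card is subadditive (difference). [folklore] -/
theorem card_support_sub_le' (P Q : ℂ[X]) : (P - Q).support.card ≤ P.support.card + Q.support.card := by
  rw [sub_eq_add_neg]
  simpa [support_neg] using card_support_add_le' P (-Q)

/-- **`χ_p` is load-bearing.**  `FeketeBoundedFaninWithoutLegendre` is false: at `s₀ = 4`, for every `δ > 0` and
every `p₀`, some prime `p ≥ p₀` carries the representation `U_p = ¼(A+B)² − ¼(A−B)² + ¼(C+1)² − ¼(C−1)²` of
support-sum `≤ 8⌊√(p−1)⌋ + 2 < p^{1/2+δ}`.  Any proof of `FeketeBoundedFanin` must use the Legendre signs. [folklore] -/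
theorem feketeBoundedFanin_false_without_legendre : ¬ FeketeBoundedFaninWithoutLegendre := by
  intro H
  obtain ⟨δ, hδ, p₀, H⟩ := H 4
  -- choose a prime p ≥ p₀ with p^δ ≥ 11
  set M : ℝ := (11 : ℝ) ^ δ⁻¹ with hM
  have hM0 : 0 ≤ M := Real.rpow_nonneg (by norm_num) _
  obtain ⟨p, hp_ge, hp⟩ := Nat.exists_infinite_primes (max p₀ (⌈M⌉₊ + 2))
  haveI : Fact p.Prime := ⟨hp⟩
  have hp0 : p₀ ≤ p := le_of_max_le_left hp_ge
  have hpc : ⌈M⌉₊ + 2 ≤ p := le_of_max_le_right hp_ge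
  have hp2 : 2 ≤ p := hp.two_le
  have hp1 : 1 ≤ p := by omega
  have hpM : M ≤ (p : ℝ) := by
    have h1 : ((⌈M⌉₊ : ℕ) : ℝ) ≤ (p : ℝ) := by exact_mod_cast (by omega : ⌈M⌉₊ ≤ p)
    exact (Nat.le_ceil M).trans h1
  -- the witness
  set k := Nat.sqrt (p - 1) with hk
  set r := p - 1 - k * k with hr
  have hkk : k * k ≤ p - 1 := Nat.sqrt_le (p - 1)
  have hr2 : r ≤ 2 * k := by
    have := Nat.sqrt_le_add (p - 1)
    rw [← hk] at this
    omega
  have hk1 : k ≤ p - 1 := by rw [hk]; exact Nat.sqrt_le_self (p - 1)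
  have hp22 : p - 1 ≤ p ^ 2 := (Nat.sub_le p 1).trans (Nat.le_self_pow two_ne_zero p)
  have hdA : (blockA k).natDegree ≤ k := natDegree_blockA k
  have hdB : (blockB k).natDegree ≤ k * k := natDegree_blockB k
  have hdC : (blockC k r).natDegree ≤ k * k + r := natDegree_blockC k r
  have h1 : (blockA k + blockB k).natDegree ≤ p ^ 2 :=
    (natDegree_add_le _ _).trans (max_le (by omega) (by omega))
  have h2 : (blockA k - blockB k).natDegree ≤ p ^ 2 :=
    (natDegree_sub_le _ _).trans (max_le (by omega) (by omega))
  have h3 : (blockC k r + 1).natDegree ≤ p ^ 2 :=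
    (natDegree_add_le _ _).trans (max_le (by omega) (by simp))
  have h4 : (blockC k r - 1).natDegree ≤ p ^ 2 :=
    (natDegree_sub_le _ _).trans (max_le (by omega) (by simp))
  have hdeg : ∀ i, ((![blockA k + blockB k, blockA k - blockB k, blockC k r + 1, blockC k r - 1] :
      Fin 4 → ℂ[X]) i).natDegree ≤ p ^ 2 := by
    intro i
    fin_cases i
    exacts [h1, h2, h3, h4]
  have hident : (∑ i, Polynomial.C ((![4⁻¹, -4⁻¹, 4⁻¹, -4⁻¹] : Fin 4 → ℂ) i) *
      (![blockA k + blockB k, blockA k - blockB k, blockC k r + 1, blockC k r - 1] : Fin 4 → ℂ[X]) i ^ 2)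
        = allOnes p := by
    rw [allOnes_eq_prod_add p k r hp1 hkk hr]
    simp only [Fin.sum_univ_four, Matrix.cons_val, map_neg]
    linear_combination (blockA k * blockB k + blockC k r) * C_inv_four_mul_four
  have hbound := H p hp0 _ _ hdeg hident
  -- support-sum ≤ 8k + 2
  have hsA := card_support_blockA k
  have hsB := card_support_blockB k
  have hsC := card_support_blockC k r
  have hs1 : (blockA k + blockB k).support.card ≤ k + k := (card_support_add_le' _ _).trans (by omega)
  have hs2 : (blockA k - blockB k).support.card ≤ k + k := (card_support_sub_le' _ _).trans (by omega)
  have hs3 : (blockC k r + 1).support.card ≤ r + 1 :=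
    (card_support_add_le' _ _).trans (Nat.add_le_add hsC card_support_one_le)
  have hs4 : (blockC k r - 1).support.card ≤ r + 1 :=
    (card_support_sub_le' _ _).trans (Nat.add_le_add hsC card_support_one_le)
  have hS : (∑ i, (((![blockA k + blockB k, blockA k - blockB k, blockC k r + 1, blockC k r - 1] :
      Fin 4 → ℂ[X]) i).support.card : ℝ)) ≤ 8 * (k : ℝ) + 2 := by
    simp only [Fin.sum_univ_four, Matrix.cons_val]
    have e1 : ((blockA k + blockB k).support.card : ℝ) ≤ k + k := by exact_mod_cast hs1
    have e2 : ((blockA k - blockB k).support.card : ℝ) ≤ k + k := by exact_mod_cast hs2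
    have e3 : ((blockC k r + 1).support.card : ℝ) ≤ r + 1 := by exact_mod_cast hs3
    have e4 : ((blockC k r - 1).support.card : ℝ) ≤ r + 1 := by exact_mod_cast hs4
    have e5 : (r : ℝ) ≤ 2 * k := by exact_mod_cast hr2
    linarith
  -- 8k + 2 < 11 √p ≤ p^{1/2+δ}
  have hp_pos : (0 : ℝ) < p := by exact_mod_cast (by omega : 0 < p)
  have hk_sqrt : (k : ℝ) ≤ Real.sqrt p := by
    refine Real.le_sqrt_of_sq_le ?_
    have : ((k * k : ℕ) : ℝ) ≤ (p : ℝ) := by exact_mod_cast (hkk.trans (Nat.sub_le p 1))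
    push_cast at this
    nlinarith
  have h1_sqrt : (1 : ℝ) ≤ Real.sqrt p :=
    Real.le_sqrt_of_sq_le (by rw [one_pow]; exact_mod_cast hp1)
  have hpd : (11 : ℝ) ≤ (p : ℝ) ^ δ := by
    have := Real.rpow_le_rpow hM0 hpM hδ.le
    rwa [hM, Real.rpow_inv_rpow (by norm_num) hδ.ne'] at this
  have hsplit : (p : ℝ) ^ (1 / 2 + δ) = Real.sqrt p * (p : ℝ) ^ δ := by
    rw [Real.rpow_add hp_pos, Real.sqrt_eq_rpow]
  have h11 : Real.sqrt p * 11 ≤ Real.sqrt p * (p : ℝ) ^ δ :=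
    mul_le_mul_of_nonneg_left hpd (Real.sqrt_nonneg _)
  rw [hsplit] at hbound
  linarith

/-! ## §A2 PRIMALITY is load-bearing: the Jacobi analogue fails at `s₀ = 2` for prime squares `n = q²` -/

/-- The crux with PRIMALITY weakened to oddness: the modulus ranges over ODD numbers `p` and `(m|p)` is the Jacobi symbol
(which is the Legendre symbol whenever `p` is prime: `jacobiSym.legendreSym.to_jacobiSym`, so on primes this is the crux
verbatim); degree cap, quantifier shape and measure unchanged. -/
def FeketeBoundedFaninJacobi : Prop :=
  ∀ s₀ : ℕ, ∃ δ : ℝ, 0 < δ ∧ ∃ p₀ : ℕ, ∀ (p : ℕ), Odd p → p₀ ≤ p → ∀ (c : Fin s₀ → ℂ) (g : Fin s₀ → Polynomial ℂ), (∀ i, (g i).natDegree ≤ p ^ 2) → (∑ i, Polynomial.C (c i) * g i ^ 2) = ∑ m ∈ Finset.range p, Polynomial.C ((jacobiSym m p : ℤ) : ℂ) * Polynomial.X ^ m → (p : ℝ) ^ (1 / 2 + δ) ≤ ∑ i, ((g i).support.card : ℝ)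

/-- Jacobi symbol modulo `q²` (`q` prime): `J(qb + a | q·q) = [a ≠ 0]` for `a < q`. [folklore] -/
theorem jacobiSym_sq_block (q : ℕ) [Fact q.Prime] (b a : ℕ) (ha : a < q) :
    jacobiSym ((q * b + a : ℕ) : ℤ) (q * q) = if a = 0 then 0 else 1 := by
  have hq0 : q ≠ 0 := (Fact.out : q.Prime).ne_zero
  rw [jacobiSym.mul_right' _ hq0 hq0, ← jacobiSym.legendreSym.to_jacobiSym]
  have hcast : (((q * b + a : ℕ) : ℤ) : ZMod q) = ((a : ℕ) : ZMod q) := by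
    push_cast
    simp
  by_cases ha0 : a = 0
  · subst ha0
    have h0 : legendreSym q ((q * b + 0 : ℕ) : ℤ) = 0 := by
      rw [legendreSym.eq_zero_iff, hcast]; simp
    rw [h0]; simp
  · have hne : (((q * b + a : ℕ) : ℤ) : ZMod q) ≠ 0 := by
      rw [hcast, Ne, ZMod.natCast_eq_zero_iff]
      intro hdvd
      exact ha0 (Nat.eq_zero_of_dvd_of_lt hdvd ha)
    rw [if_neg ha0, ← sq, legendreSym.sq_one (p := q) hne]

/-- The digit identity for the Jacobi–Fekete polynomial of a prime square:
`∑_{m<qN} J(m | q²) X^m = (∑_{1≤a<q} X^a) · ∑_{b<N} X^{qb}`. [folklore] -/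
theorem jacobi_sq_sum_eq (q : ℕ) [Fact q.Prime] (N : ℕ) :
    ∑ m ∈ range (q * N), C ((jacobiSym (m : ℤ) (q * q) : ℤ) : ℂ) * (X : ℂ[X]) ^ m =
      (∑ a ∈ range (q - 1), (X : ℂ[X]) ^ (a + 1)) * ∑ b ∈ range N, (X : ℂ[X]) ^ (q * b) := by
  have hq1 : 1 ≤ q := (Fact.out : q.Prime).one_lt.le
  obtain ⟨Q, hQ⟩ : ∃ Q, q = Q + 1 := ⟨q - 1, by omega⟩
  have hQ' : q - 1 = Q := by omega
  rw [hQ']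
  induction N with
  | zero => simp
  | succ N ih =>
    rw [Nat.mul_succ, Finset.sum_range_add, ih, Finset.sum_range_succ, mul_add]
    congr 1
    have h0 : jacobiSym ((q * N + 0 : ℕ) : ℤ) (q * q) = 0 := by
      rw [jacobiSym_sq_block q N 0 (by omega)]; simp
    have h1 : ∀ a, a < Q → jacobiSym ((q * N + (a + 1) : ℕ) : ℤ) (q * q) = 1 := fun a haQ => by
      rw [jacobiSym_sq_block q N (a + 1) (by omega)]; simp
    have hsplit : ∑ a ∈ range q, C ((jacobiSym ((q * N + a : ℕ) : ℤ) (q * q) : ℤ) : ℂ) * (X : ℂ[X]) ^ (q * N + a)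
        = ∑ a ∈ range Q, C ((jacobiSym ((q * N + (a + 1) : ℕ) : ℤ) (q * q) : ℤ) : ℂ) * (X : ℂ[X]) ^ (q * N + (a + 1))
          + C ((jacobiSym ((q * N + 0 : ℕ) : ℤ) (q * q) : ℤ) : ℂ) * (X : ℂ[X]) ^ (q * N + 0) := by
      subst hQ
      exact Finset.sum_range_succ' _ _
    rw [hsplit, h0, Finset.sum_mul]
    simp only [Int.cast_zero, map_zero, zero_mul, add_zero]
    refine Finset.sum_congr rfl fun a haQ => ?_
    rw [Finset.mem_range] at haQ
    rw [h1 a haQ]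
    simp only [Int.cast_one, map_one, one_mul, ← pow_add]
    congr 1; ring


/-- **Primality is load-bearing.**  `FeketeBoundedFaninJacobi` is false already at `s₀ = 2`: for a prime `q` the
Jacobi–Fekete polynomial of `n = q²` is ONE sparse product, `∑_{m<q²} J(m|q²) X^m = (∑_{1≤a<q} X^a)(∑_{b<q} X^{qb})`
(`J(m|q²) = [q ∤ m]`), i.e. `¼(A+B)² − ¼(A−B)²` with support-sum `≤ 4q − 2 < 5q ≤ n^{1/2+δ}` once `q^{2δ} ≥ 5`.
So any proof of `FeketeBoundedFanin` must use that `p` is prime (at least squarefree) beyond the typing of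
`legendreSym`: periodicity of `χ` modulo a proper divisor is exactly the digit structure that makes squares cheap.
[folklore] -/
theorem feketeBoundedFanin_false_with_jacobi : ¬ FeketeBoundedFaninJacobi := by
  intro H
  obtain ⟨δ, hδ, p₀, H⟩ := H 2
  have h2δ : (2 * δ) ≠ 0 := by positivity
  set M : ℝ := (5 : ℝ) ^ (2 * δ)⁻¹ with hM
  have hM0 : 0 ≤ M := Real.rpow_nonneg (by norm_num) _
  obtain ⟨q, hq_ge, hq⟩ := Nat.exists_infinite_primes (max p₀ (⌈M⌉₊ + 3))
  haveI : Fact q.Prime := ⟨hq⟩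
  have hq0 : p₀ ≤ q := le_of_max_le_left hq_ge
  have hqc : ⌈M⌉₊ + 3 ≤ q := le_of_max_le_right hq_ge
  have hq3 : 3 ≤ q := by omega
  have hqodd : Odd q := hq.odd_of_ne_two (by omega)
  have hnodd : Odd (q * q) := hqodd.mul hqodd
  have hn0 : p₀ ≤ q * q := hq0.trans (Nat.le_mul_self q)
  have hqM : M ≤ (q : ℝ) := (Nat.le_ceil M).trans (by exact_mod_cast (by omega : ⌈M⌉₊ ≤ q))
  -- the witness: A = blockA (q-1), B = blockB q, target = A * B
  have hAB : ∑ m ∈ Finset.range (q * q), Polynomial.C ((jacobiSym m (q * q) : ℤ) : ℂ) * Polynomial.X ^ m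
      = blockA (q - 1) * blockB q := by
    rw [jacobi_sq_sum_eq q q, blockA, blockB]
  have hdA : (blockA (q - 1)).natDegree ≤ q - 1 := natDegree_blockA (q - 1)
  have hdB : (blockB q).natDegree ≤ q * q := natDegree_blockB q
  have hqq' : q * q ≤ (q * q) ^ 2 := by rw [pow_two]; exact Nat.le_mul_self (q * q)
  have hqq : q - 1 ≤ (q * q) ^ 2 := ((Nat.sub_le q 1).trans (Nat.le_mul_self q)).trans hqq'
  have h1 : (blockA (q - 1) + blockB q).natDegree ≤ (q * q) ^ 2 :=
    (natDegree_add_le _ _).trans (max_le (by omega) (by omega))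
  have h2 : (blockA (q - 1) - blockB q).natDegree ≤ (q * q) ^ 2 :=
    (natDegree_sub_le _ _).trans (max_le (by omega) (by omega))
  have hdeg : ∀ i, ((![blockA (q - 1) + blockB q, blockA (q - 1) - blockB q] : Fin 2 → ℂ[X]) i).natDegree
      ≤ (q * q) ^ 2 := by
    intro i
    fin_cases i
    exacts [h1, h2]
  have hident : (∑ i, Polynomial.C ((![4⁻¹, -4⁻¹] : Fin 2 → ℂ) i) *
      (![blockA (q - 1) + blockB q, blockA (q - 1) - blockB q] : Fin 2 → ℂ[X]) i ^ 2)
        = ∑ m ∈ Finset.range (q * q), Polynomial.C ((jacobiSym m (q * q) : ℤ) : ℂ) * Polynomial.X ^ m := by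
    rw [hAB]
    simp only [Fin.sum_univ_two, Matrix.cons_val_zero, Matrix.cons_val_one, map_neg]
    linear_combination (blockA (q - 1) * blockB q) * C_inv_four_mul_four
  have hbound := H (q * q) hnodd hn0 _ _ hdeg hident
  -- support-sum ≤ 4q − 2
  have hsA := card_support_blockA (q - 1)
  have hsB := card_support_blockB q
  have hs1 : (blockA (q - 1) + blockB q).support.card ≤ (q - 1) + q := (card_support_add_le' _ _).trans (by omega)
  have hs2 : (blockA (q - 1) - blockB q).support.card ≤ (q - 1) + q := (card_support_sub_le' _ _).trans (by omega)
  have hS : (∑ i, (((![blockA (q - 1) + blockB q, blockA (q - 1) - blockB q] : Fin 2 → ℂ[X]) i).support.card : ℝ))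
      ≤ 4 * (q : ℝ) - 2 := by
    simp only [Fin.sum_univ_two, Matrix.cons_val_zero, Matrix.cons_val_one]
    have hq1 : 1 ≤ q := by omega
    have e1 : ((blockA (q - 1) + blockB q).support.card : ℝ) ≤ 2 * (q : ℝ) - 1 := by
      have : (((blockA (q - 1) + blockB q).support.card : ℕ) : ℝ) ≤ ((q - 1 + q : ℕ) : ℝ) := by exact_mod_cast hs1
      rw [Nat.cast_add, Nat.cast_sub hq1] at this; push_cast at this; linarith
    have e2 : ((blockA (q - 1) - blockB q).support.card : ℝ) ≤ 2 * (q : ℝ) - 1 := by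
      have : (((blockA (q - 1) - blockB q).support.card : ℕ) : ℝ) ≤ ((q - 1 + q : ℕ) : ℝ) := by exact_mod_cast hs2
      rw [Nat.cast_add, Nat.cast_sub hq1] at this; push_cast at this; linarith
    linarith
  -- 4q − 2 < 5q ≤ q · q^{2δ} = (q²)^{1/2+δ}
  have hq_pos : (0 : ℝ) < q := by exact_mod_cast (by omega : 0 < q)
  have hqd : (5 : ℝ) ≤ (q : ℝ) ^ (2 * δ) := by
    have := Real.rpow_le_rpow hM0 hqM (by positivity : 0 ≤ 2 * δ)
    rwa [hM, Real.rpow_inv_rpow (by norm_num) h2δ] at this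
  have hsplit : ((q * q : ℕ) : ℝ) ^ (1 / 2 + δ) = (q : ℝ) * (q : ℝ) ^ (2 * δ) := by
    have e : ((q * q : ℕ) : ℝ) = (q : ℝ) ^ (2 : ℕ) := by push_cast; ring
    rw [e, ← Real.rpow_natCast_mul hq_pos.le 2 (1 / 2 + δ)]
    rw [show ((2 : ℕ) : ℝ) * (1 / 2 + δ) = 1 + 2 * δ by push_cast; ring]
    rw [Real.rpow_add hq_pos, Real.rpow_one]
  have h5 : (q : ℝ) * 5 ≤ (q : ℝ) * (q : ℝ) ^ (2 * δ) := mul_le_mul_of_nonneg_left hqd hq_pos.le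
  rw [hsplit] at hbound
  linarith

/-! ## §B Non-vacuity and the trivial ceiling `2p + 2` at `s₀ = 2` -/

/-- The Fekete target, typed exactly as in the crux. -/
def fekete (p : ℕ) [Fact p.Prime] : ℂ[X] :=
  ∑ m ∈ Finset.range p, Polynomial.C ((legendreSym p m : ℤ) : ℂ) * Polynomial.X ^ m

/-- `deg F_p ≤ p − 1`. [folklore] -/
theorem natDegree_fekete_le (p : ℕ) [Fact p.Prime] : (fekete p).natDegree ≤ p - 1 := by
  unfold fekete
  exact natDegree_sum_le_of_forall_le _ _ fun m hm =>
    (natDegree_C_mul_X_pow_le _ _).trans (by simp at hm; omega)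

/-- `F_p` has at most `p` monomials. [folklore] -/
theorem card_support_fekete_le (p : ℕ) [Fact p.Prime] : (fekete p).support.card ≤ p := by
  unfold fekete
  have h := card_support_sum_le (range p) (fun m => C ((legendreSym p (m : ℤ) : ℤ) : ℂ) * (X : ℂ[X]) ^ m)
  have h2 : ∑ m ∈ range p, (C ((legendreSym p (m : ℤ) : ℤ) : ℂ) * (X : ℂ[X]) ^ m).support.card ≤ ∑ m ∈ range p, 1 :=
    Finset.sum_le_sum fun m _ => card_support_C_mul_X_pow_le_one
  simp only [Finset.sum_const, Finset.card_range, smul_eq_mul, mul_one] at h2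
  exact h.trans h2

/-- `[X⁰] F_p = χ_p(0) = 0`. [folklore] -/
theorem coeff_fekete_zero (p : ℕ) [Fact p.Prime] : (fekete p).coeff 0 = 0 := by
  simp [fekete]

/-- `[X¹] F_p = χ_p(1) = 1`. [folklore] -/
theorem coeff_fekete_one (p : ℕ) [Fact p.Prime] : (fekete p).coeff 1 = 1 := by
  have hp : 1 < p := (Fact.out : p.Prime).one_lt
  simp [fekete, hp]

/-- `F_p` is not a constant times a square: `X ∥ F_p` (coefficient `0` at `X⁰`, `χ_p(1) = 1` at `X¹`). [folklore] -/
theorem C_mul_sq_ne_fekete (p : ℕ) [Fact p.Prime] (c : ℂ) (g : ℂ[X]) : C c * g ^ 2 ≠ fekete p := by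
  intro h
  have h0 : (C c * g ^ 2).coeff 0 = 0 := by rw [h, coeff_fekete_zero]
  have h1 : (C c * g ^ 2).coeff 1 = 1 := by rw [h, coeff_fekete_one]
  rw [coeff_C_mul, pow_two, mul_coeff_zero] at h0
  rcases mul_eq_zero.mp h0 with hc | hg
  · rw [hc, map_zero, zero_mul, coeff_zero] at h1
    exact zero_ne_one h1
  · have hg0 : g.coeff 0 = 0 := by
      rcases mul_eq_zero.mp hg with h' | h' <;> exact h'
    have hX : (X : ℂ[X]) ^ 2 ∣ C c * g ^ 2 :=
      dvd_mul_of_dvd_right (pow_dvd_pow_of_dvd (X_dvd_iff.mpr hg0) 2) _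
    have := (X_pow_dvd_iff.mp hX) 1 (by norm_num)
    rw [h1] at this
    exact one_ne_zero this

/-- **Vacuity at `s₀ = 0`**: the empty sum is `0 ≠ F_p`, so the crux's hypothesis is unsatisfiable there. [folklore] -/
theorem feketeBoundedFanin_vacuous_at_zero (p : ℕ) [Fact p.Prime] (c : Fin 0 → ℂ) (g : Fin 0 → ℂ[X]) :
    (∑ i, Polynomial.C (c i) * g i ^ 2) ≠ fekete p := by
  intro h
  have h1 := congrArg (fun q => Polynomial.coeff q 1) h
  simp only [Finset.univ_eq_empty, Finset.sum_empty, coeff_zero, coeff_fekete_one] at h1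
  exact zero_ne_one h1

/-- **Vacuity at `s₀ = 1`**: `c·g² ≠ F_p`, so the crux's hypothesis is unsatisfiable there too; exactly the cases
`s₀ ≥ 2` carry content. [folklore] -/
theorem feketeBoundedFanin_vacuous_at_one (p : ℕ) [Fact p.Prime] (c : Fin 1 → ℂ) (g : Fin 1 → ℂ[X]) :
    (∑ i, Polynomial.C (c i) * g i ^ 2) ≠ fekete p := by
  rw [Fin.sum_univ_one]
  exact C_mul_sq_ne_fekete p (c 0) (g 0)

/-- **Non-vacuity / trivial ceiling.**  For every prime `p` the hypotheses of `FeketeBoundedFanin` are satisfiable at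
`s₀ = 2`: `F_p = ¼(F_p+1)² − ¼(F_p−1)²` with degrees `≤ p − 1 ≤ p²` and support-sum `≤ 2p + 2`.  So every case
`s₀ ≥ 2` has content, and the minimal support-sum for fixed `s₀ ≥ 2` lies between the claimed `p^{1/2+δ}` and `2p+2`.
[folklore] -/
theorem feketeBoundedFanin_hypotheses_inhabited (p : ℕ) [Fact p.Prime] :
    ∃ (c : Fin 2 → ℂ) (g : Fin 2 → ℂ[X]), (∀ i, (g i).natDegree ≤ p ^ 2) ∧
      (∑ i, Polynomial.C (c i) * g i ^ 2) = ∑ m ∈ Finset.range p, Polynomial.C ((legendreSym p m : ℤ) : ℂ) * Polynomial.X ^ m ∧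
      (∑ i, (g i).support.card) ≤ 2 * p + 2 := by
  have hp : 2 ≤ p := (Fact.out : p.Prime).two_le
  have hF := natDegree_fekete_le p
  have hp22 : p - 1 ≤ p ^ 2 := (Nat.sub_le p 1).trans (Nat.le_self_pow two_ne_zero p)
  have h1 : (fekete p + 1).natDegree ≤ p ^ 2 := (natDegree_add_le _ _).trans (max_le (by omega) (by simp))
  have h2 : (fekete p - 1).natDegree ≤ p ^ 2 := (natDegree_sub_le _ _).trans (max_le (by omega) (by simp))
  have hsF := card_support_fekete_le p
  have hs1 : (fekete p + 1).support.card ≤ p + 1 :=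
    (card_support_add_le' _ _).trans (Nat.add_le_add hsF card_support_one_le)
  have hs2 : (fekete p - 1).support.card ≤ p + 1 :=
    (card_support_sub_le' _ _).trans (Nat.add_le_add hsF card_support_one_le)
  refine ⟨![4⁻¹, -4⁻¹], ![fekete p + 1, fekete p - 1], ?_, ?_, ?_⟩
  · intro i
    fin_cases i
    exacts [h1, h2]
  · change _ = fekete p
    simp only [Fin.sum_univ_two, Matrix.cons_val_zero, Matrix.cons_val_one, map_neg]
    linear_combination (fekete p) * C_inv_four_mul_four
  · simp only [Fin.sum_univ_two, Matrix.cons_val_zero, Matrix.cons_val_one]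
    omega

/-! ## §C Small models — numbers (local pure-python, folder `local/`; kit jobs pending are listed in §R.4) -/

/-- **§C.1 The obstruction-silent shape `F_p = (1 − X^f)·B + c·C²`, honest polynomials** (`local/honest_3term.py`:
all `f < p`, `C ∈ {0, X^e, X^e ± X^g : e < g ≤ p+1}`, `c ∈ {±1, ±2}`, exact division over `ℤ`).
2-term minima `min_f (2 + |F_p/(1−X^f)|)` for `p = 5,7,11,13,17,19,23,29`: `4,7,9,10,14,15,23,22` — EXACTLY the
exhaustive `ℂ`-factorisation minima of the route review (so every sub-generic splitting of `F_p`, `p ≤ 29`, is a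
`(1−X)`-peeling; for `p = 23, 31, 47` no peeling saves anything).  Best 3-term totals `2 + |B| + |C|`:
`p:  11 13 17 19 23 29 31 37 41 43 47 53 59 61`
`2t:  9 10 14 15 23 22 31 30 34 33 47 40 55 52`
`3t: 10 10 14 15 24 21 30 26 33 33 48 39 51 45`   — sporadic savings `≤ 7`, ratio `3t/p ∈ [0.70, 1.04]`: LINEAR,
no structure.  (In the crux's squares measure these are `≈ 2·(3t)`, i.e. `≥ 1.4p`.)
**§C.2 The same shape CYCLICALLY over `ℚ`** (`local/cyc_char0_v2.py`: identities `mod X^p − 1`, `B` optimised over the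
free constant): `p = 11`: `8 < 9` (`F_11 ≡ (1−X⁵)(X³−X⁴+X⁵−X⁷) − (X−X³)²`, honest up to the single wrap `X¹² ↦ X`),
`17: 12 < 14`, `19: 13 < 15`, `29: 21 < 22`, `31: 22 < 26`, `37: 26 < 30`, `41: 28 < 34`, `43: 32 < 33`, else equal;
ratio `∈ [0.68, 0.77]`.  So the cyclic relaxation is slightly SOFTER for three terms than for two (the `s = 2` cyclic
bound `(p+3)/2 = 7` of the sibling card is not violated by the 3-term value `8` at `p = 11`, while the best 2-term
cyclic value within `(1−X^f)`-shapes there is `9`), yet still linear.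
**§C.3 The cyclic char-`p` shadow** (`local/cyc_shadow.py`, exhaustive over `A ∈ {1, 1+αX^f}`, `C` ≤ 2 terms, all
`c`, `B := (F̄_p − cC²)/A` in `𝔽_p[X]/(X^p−1)`): minima `4, 6, 8` at `p = 5, 7, 11` against the 2-term shadow minima
`4, 6, 9` — the char-`p` information degrades by one unit at `p = 11` exactly where §C.2's identity lives (it IS that
identity read mod 11).  Verdict of §C: within binomial `A` and binomial `C` nothing sub-linear exists up to `p = 61`;
the general sparse-`A` case is kit job j010035–8 (exact Gröbner), all-supports `s₀ = 3` is j008168–73, digit grids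
j009356 — PENDING at v4; a successor folds `~/compute/<id>/outputs/*summary.json` in here. -/
theorem smallModels_remark : True := trivial

end

end Summit.ValiantsHypothesis.ValiantsHypothesis.Cruxes.FeketeBoundedFanin.Disproof
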